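import Summits.CriticalPhenomena.SAWScalingLimit.Theses.SAWCompassLattice
import Summits.CriticalPhenomena.SAWScalingLimit.Theses.SAWTrackTransport
import Summits.CriticalPhenomena.SAWScalingLimit.Theorems.SAWDevelopingMapHexTransferAngleTransportOfTrackTransport
import Literature.Probability.RandomPlanarGeometry.SLEConvergenceCriterion

/-!
# Stub I2b of the `CompassSLE` skeleton reduces to the items of route SAWTrackTransport
# (crux stmt-CriticalPhenomena-6965, line `registered`, lead c2)

Stub I2b (`stub_ybSubseqLimitSimple`) of `Cruxes/CompassSLE/Lines/birth.lean` (v4): every probability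
subsequential weak limit `ν` of the curve laws of Glazman–Manolescu's critical `π/2` Yang–Baxter walk
(`ybLaw (fun _ => π/2) D.carrier δ 1 (a δ) (b δ)` pushed to `CurveClass ℂ` by `YBWalk.curve`), along a
mesh sequence `s n → 0⁺`, is carried by SIMPLE curves. It is an open problem (no uniform
no-macroscopic-self-touching estimate is known for any critical SAW-type model) and it is implied by
the crux (`ybSubseqLimitSimple_of_ybSquareSLE`).

This file certifies that I2b is ALSO a consequence of two EXISTING items of the sibling route
SAWTrackTransport, taken here as hypotheses:

* `SAWTrackTransport.YBLimitExists` (stmt-CriticalPhenomena-16995): (i) endpoint approximations exist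
  at every angle `α ∈ [π/3, 2π/3]`, (ii) the critical square-tiling Yang–Baxter walk has a ROBUST FULL
  chordal scaling limit `P : ChordalFamily` (`P.IsChordal ∧ RL (π/2) P`);
* `SAWTrackTransport.AxiomsOfLimit` (stmt-CriticalPhenomena-16965): such a `P` is, among other
  axioms, carried by simple curves meeting `∂D` only at the marked points.

Contents:

* (reused, landed in `Theorems/SAWDevelopingMapHexTransferAngleTransportOfTrackTransport.lean`)
  `Cruxes.HexTransfer.YbRelay.tendstoLaw_of_robustLimit` — the robust-limit hypothesis `RL (α) P`,
  specialised to the UNSHIFTED domain (`u ≡ 0`; `(D.map (similarity 1 _ 0)).carrier = D.carrier`,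
  transported by `subst` as in `SAWTrackTransport.closes`), gives convergence in law of the pushed
  curve laws of every endpoint approximation of `D` to `P D` along `𝓝[>] 0`.
* `eq_of_subseqLimit_of_tendstoLaw` — (model-free) a probability subsequential weak limit along
  `s n → 0⁺` of laws that converge in law along the whole filter `𝓝[>] 0` to a probability measure
  `μ` IS `μ` (uniqueness of weak limits on `CurveClass ℂ`, `ext_of_forall_integral_eq_of_IsFiniteMeasure`
  + `tendsto_nhds_unique`); `eq_of_isSubseqLimitLaw_of_tendstoLaw` is the same for `IsSubseqLimitLaw`.
* `ybFullLimit_of_ybLimitExists` — `YBLimitExists` ⇒ the `π/2` curve laws of every port endpoint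
  approximation have a FULL weak limit (a probability measure) along `𝓝[>] 0` (the T-side input: a
  full weak limit is in particular tight along the mesh).
* `ybSubseqLimitSimpleBoundary_of_trackTransport` — `YBLimitExists → AxiomsOfLimit →` every
  probability subsequential weak limit is carried by simple curves meeting `∂D` only at the marked
  points (it IS `P D`, and axiom (vi) of `AxiomsOfLimit` is exactly this carrier statement).
* `ybSubseqLimitSimple_of_trackTransport` — `YBLimitExists → AxiomsOfLimit →` stub I2b verbatim.
-/

noncomputable section

namespace Summit.CriticalPhenomena.SAWScalingLimit.Theorems.SAWCompassLatticeCompassSLE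

open MeasureTheory Filter Topology Set
open scoped NNReal ENNReal
open Literature.Probability.RandomPlanarGeometry
open Literature.Probability.RandomPlanarGeometry.SAW.YangBaxter
open Summit.CriticalPhenomena.SAWScalingLimit.Theses

/-- `π/2` lies in Glazman–Manolescu's range of angles `[π/3, 2π/3]`. -/
theorem pi_div_two_mem_Icc : Real.pi / 2 ∈ Set.Icc (Real.pi / 3) (2 * Real.pi / 3) := by
  constructor <;> nlinarith [Real.pi_pos]

/-- **Uniqueness of weak limits (model-free).** If the pushed laws `(P δ) ∘ (Y δ)⁻¹` converge in
law along the whole mesh filter `𝓝[>] 0` to a probability measure `μ` on `CurveClass ℂ`, then every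
probability subsequential weak limit `ν` along a mesh sequence `s n → 0⁺` equals `μ`
(`tendsto_nhds_unique` on each bounded continuous test function, then
`ext_of_forall_integral_eq_of_IsFiniteMeasure`). -/
theorem eq_of_subseqLimit_of_tendstoLaw {Ωδ : ℝ → Type*} [∀ δ, MeasurableSpace (Ωδ δ)]
    {Y : ∀ δ, Ωδ δ → CurveClass ℂ} {P : ∀ δ, Measure (Ωδ δ)} {μ ν : Measure (CurveClass ℂ)}
    [IsProbabilityMeasure μ] [IsProbabilityMeasure ν] (hT : TendstoLaw Y P id μ)
    {s : ℕ → ℝ} (hs : Tendsto s atTop (𝓝[>] (0 : ℝ)))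
    (hlim : ∀ f : BoundedContinuousFunction (CurveClass ℂ) ℝ,
      Tendsto (fun n => ∫ ω, f (Y (s n) ω) ∂P (s n)) atTop (𝓝 (∫ x, f x ∂ν))) :
    ν = μ := by
  apply ext_of_forall_integral_eq_of_IsFiniteMeasure
  intro f
  exact tendsto_nhds_unique (hlim f) ((hT f).comp hs)

/-- `IsSubseqLimitLaw` form of `eq_of_subseqLimit_of_tendstoLaw`: a probability subsequential limit
law of laws converging in law along `𝓝[>] 0` to the probability measure `μ` is `μ`. -/
theorem eq_of_isSubseqLimitLaw_of_tendstoLaw {Ωδ : ℝ → Type*} [∀ δ, MeasurableSpace (Ωδ δ)]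
    {Y : ∀ δ, Ωδ δ → CurveClass ℂ} {P : ∀ δ, Measure (Ωδ δ)} {μ ν : Measure (CurveClass ℂ)}
    [IsProbabilityMeasure μ] [IsProbabilityMeasure ν] (hν : IsSubseqLimitLaw Y P ν)
    (hT : TendstoLaw Y P id μ) : ν = μ := by
  obtain ⟨s, hs, hlim⟩ := hν
  exact eq_of_subseqLimit_of_tendstoLaw hT hs hlim

/-- **`YBLimitExists` ⇒ a full weak limit of the `π/2` Yang–Baxter curve laws exists** (the T-side
input of the `CompassSLE` skeleton: convergence in law along the whole filter `𝓝[>] 0` to a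
probability measure; a full weak limit is in particular a tight family along the mesh). For every
Dobrushin domain and every port endpoint approximation the limit is `P D`, `P` the robust full limit
of item stmt-CriticalPhenomena-16995 (`YbRelay.tendstoLaw_of_robustLimit`), a probability measure
because `P` is chordal. -/
theorem ybFullLimit_of_ybLimitExists :
    SAWTrackTransport.YBLimitExists →
    ∀ (D : DobrushinDomain) (a b : ℝ → MidEdge),
      IsYBEndpointApprox (fun (_ : ℤ) => Real.pi / 2) D a b →
      ∃ μ : Measure (CurveClass ℂ), IsProbabilityMeasure μ ∧
        ∀ f : BoundedContinuousFunction (CurveClass ℂ) ℝ,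
          Tendsto (fun δ => ∫ γ, f (γ.curve (fun (_ : ℤ) => Real.pi / 2) δ)
              ∂(ybLaw (fun (_ : ℤ) => Real.pi / 2) D.carrier δ 1 (a δ) (b δ)))
            (𝓝[>] (0 : ℝ)) (𝓝 (∫ x, f x ∂μ)) := by
  intro hL D a b hab
  obtain ⟨-, P, hPch, hconv⟩ := hL
  exact ⟨P D, (hPch D).1,
    Cruxes.HexTransfer.YbRelay.tendstoLaw_of_robustLimit (Real.pi / 2) P hconv D a b hab⟩

/-- **Subsequential limits inherit the carrier axiom of the robust limit.** Given the robust full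
limit `P` of the critical square-tiling Yang–Baxter walk (item `YBLimitExists`,
stmt-CriticalPhenomena-16995; `π/2 ∈ [π/3, 2π/3]` supplies the square-tiling endpoint approximations
of every Dobrushin domain that `AxiomsOfLimit` asks for) and the axioms of that limit (item
`AxiomsOfLimit`, stmt-CriticalPhenomena-16965, whose last conjunct is: `P D`-a.e. curve class is
simple and meets `∂D` only at the marked points), every probability subsequential weak limit `ν` of
the pushed `π/2` curve laws along `s n → 0⁺` equals `P D` (`YbRelay.tendstoLaw_of_robustLimit` +
`eq_of_subseqLimit_of_tendstoLaw`), hence `ν`-a.e. curve class is simple AND its range meets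
`frontier D.carrier` only inside `{D.pt 0, D.pt 1}` (the boundary-avoidance clause of the SLE(8/3)
carrier, which the `CompassSLE` skeleton otherwise derives from I1 + I2a + I3). -/
theorem ybSubseqLimitSimpleBoundary_of_trackTransport :
    SAWTrackTransport.YBLimitExists → SAWTrackTransport.AxiomsOfLimit →
    ∀ (D : DobrushinDomain) (a b : ℝ → MidEdge),
      IsYBEndpointApprox (fun (_ : ℤ) => Real.pi / 2) D a b →
      ∀ (s : ℕ → ℝ) (ν : Measure (CurveClass ℂ)), Tendsto s atTop (𝓝[>] (0 : ℝ)) →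
        IsProbabilityMeasure ν →
        (∀ f : BoundedContinuousFunction (CurveClass ℂ) ℝ,
          Tendsto (fun n => ∫ γ, f (γ.curve (fun (_ : ℤ) => Real.pi / 2) (s n))
              ∂(ybLaw (fun (_ : ℤ) => Real.pi / 2) D.carrier (s n) 1 (a (s n)) (b (s n))))
            atTop (𝓝 (∫ x, f x ∂ν))) →
        ∀ᵐ γ ∂ν, γ ∈ CurveClass.simple ∧ γ.range ∩ frontier D.carrier ⊆ {D.pt 0, D.pt 1} := by
  intro hL hAx D a b hab s ν hs hν hlim
  -- endpoint approximations at every angle, and the robust full limit `P` of the square-tiling walk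
  obtain ⟨happAll, P, hPch, hconv⟩ := hL
  have hEnd : ∀ D : DobrushinDomain, ∃ a b : ℝ → MidEdge,
      IsYBEndpointApprox (fun (_ : ℤ) => Real.pi / 2) D a b :=
    fun D => happAll (Real.pi / 2) pi_div_two_mem_Icc D
  -- the axioms of the limit: only the carrier axiom (vi) is used
  obtain ⟨-, -, -, -, -, hSimple⟩ := hAx P hPch hEnd hconv
  -- the pushed `π/2` curve laws converge in law to `P D` along the whole mesh filter
  have hfix :=
    Cruxes.HexTransfer.YbRelay.tendstoLaw_of_robustLimit (Real.pi / 2) P hconv D a b hab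
  haveI : IsProbabilityMeasure (P D) := (hPch D).1
  -- uniqueness of weak limits: `ν = P D`
  have key : ν = P D := eq_of_subseqLimit_of_tendstoLaw hfix hs hlim
  rw [key]
  exact hSimple D

/-- **Stub I2b reduces to the items `YBLimitExists` + `AxiomsOfLimit` of route SAWTrackTransport**:
the first conjunct of `ybSubseqLimitSimpleBoundary_of_trackTransport`. The conclusion (after the two
item hypotheses) is the registered stub `stub_ybSubseqLimitSimple` of
`Cruxes/CompassSLE/Lines/birth.lean` (v4) verbatim: every probability subsequential weak limit of the
pushed critical `π/2` Yang–Baxter curve laws along `s n → 0⁺` is carried by simple curves. -/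
theorem ybSubseqLimitSimple_of_trackTransport :
    SAWTrackTransport.YBLimitExists → SAWTrackTransport.AxiomsOfLimit →
    ∀ (D : DobrushinDomain) (a b : ℝ → MidEdge),
      IsYBEndpointApprox (fun (_ : ℤ) => Real.pi / 2) D a b →
      ∀ (s : ℕ → ℝ) (ν : Measure (CurveClass ℂ)), Tendsto s atTop (𝓝[>] (0 : ℝ)) →
        IsProbabilityMeasure ν →
        (∀ f : BoundedContinuousFunction (CurveClass ℂ) ℝ,
          Tendsto (fun n => ∫ γ, f (γ.curve (fun (_ : ℤ) => Real.pi / 2) (s n))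
              ∂(ybLaw (fun (_ : ℤ) => Real.pi / 2) D.carrier (s n) 1 (a (s n)) (b (s n))))
            atTop (𝓝 (∫ x, f x ∂ν))) →
        ∀ᵐ γ ∂ν, γ ∈ CurveClass.simple :=
  fun hL hAx D a b hab s ν hs hν hlim =>
    (ybSubseqLimitSimpleBoundary_of_trackTransport hL hAx D a b hab s ν hs hν hlim).mono
      fun _ h => h.1

end Summit.CriticalPhenomena.SAWScalingLimit.Theorems.SAWCompassLatticeCompassSLE

end
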